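import Summits.ResolutionOfSingularities.ResolutionOfSingularities.Theorems.FrobeniusLadderFRationalResolutionMonoidAlgebraLaurent
import HarnessLib

/-!
# Crux `FrobeniusLadder.FRationalResolution` (stmt-ResolutionOfSingularities-15317), line `redirect`,
# stub `stub_diagonalizableQuotientResolution` — THE LOCALIZATION OF A MONOID ALGEBRA AT A MONOMIAL IS A MONOID ALGEBRA
# (`κ[Q][1/χᵍ] ≅ κ[M]`, `M ≅ Q + ℤ(−g)`): the FACE-REGULARITY slot of `…MonoidAlgebraChartCertificate.chartCertificate_of_cone`

`chartCertificate_of_cone` (p843560) asks, for the generators `g` of the chart cone monoid `Q`, that `κ[Q][1/χᵍ]` be a regular ring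
(the proper faces of the cone are regular). Here is the structure theorem that turns this into monoid combinatorics: for an abstract
additive monoid `M` with an injective `ι' : M → ℤⁿ'` onto `Q − ℕg` (three elementary hypotheses), `κ[M] ≃ₐ[κ] κ[Q][1/χᵍ]`. Read in
one direction it identifies the face ring (`M` the face-localized monoid, which the class-prover shows `≃+ ℕᵃ × ℤᵇ` by hand); read in the
other (with `Q = ℕ^{a+b}`, `g = (0,…,0,1,…,1)`) it shows `κ[ℕᵃ × ℤᵇ]` is a localization of a polynomial ring, hence regular.

* ★★★ `exists_algEquiv_away` — `Ψ : κ[M] ≃ₐ[κ] κ[Q][1/χᵍ]` with `Ψ(x^m)·(χᵍ)^k = χ^q` whenever `ι' m + k g = q`;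
* ★★ `isRegularRing_away_iff_of_monoid` — hence `κ[Q][1/χᵍ]` is regular iff `κ[M]` is.

Honest label: elementary toric algebra toward ONE leaf stub (no stub, crux or summit closed). No definitions, no named facts, no sorry.
[folklore; cite: CoxLittleSchenck2011, §1.1 (localization at a face)]
-/

noncomputable section

-- single-problem summit: the doubled namespace component is forced
set_option linter.dupNamespace false

namespace Summit.ResolutionOfSingularities.ResolutionOfSingularities.Theorems.FRationalResolution.MonoidAlgebraLaurent

variable (κ : Type) [Field κ] {n : ℕ} (Q : AddSubmonoid (Fin n →₀ ℕ))

/-- The exponent of `p ∈ ℕⁿ` in `ℤⁿ`. -/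
local notation3 (prettyPrint := false) "toZ" =>
  (Finsupp.mapRange.addMonoidHom (Nat.castAddMonoidHom ℤ) : (Fin n →₀ ℕ) →+ (Fin n →₀ ℤ))

/-- ★★★ **`κ[Q][1/χᵍ] ≅ κ[M]` FOR THE LOCALIZED MONOID `M ≅ Q − ℕg`.** `M` an additive commutative monoid with an injective additive
`ι' : M → ℤⁿ` such that (a) every `ι' m` is `q − k g` (`q ∈ Q`), (b) every `q ∈ Q` is an `ι' m`, (c) `−g` is an `ι' m₀`. Then there is a
`κ`-algebra isomorphism `Ψ : κ[M] ≃ₐ[κ] κ[Q][1/χᵍ]` with `Ψ(x^m)·(χᵍ)^k = χ^q` whenever `ι' m + k g = q`.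
[folklore; cite: CoxLittleSchenck2011, §1.1] -/
theorem exists_algEquiv_away (g : ↥Q) {M : Type} [AddCommMonoid M] (ι' : M →+ (Fin n →₀ ℤ)) (hι' : Function.Injective ι')
    (hM : ∀ m : M, ∃ (q : ↥Q) (k : ℕ), ι' m + k • toZ (g : Fin n →₀ ℕ) = toZ (q : Fin n →₀ ℕ))
    (hQM : ∀ q : ↥Q, ∃ m : M, ι' m = toZ (q : Fin n →₀ ℕ)) (hgM : ∃ m₀ : M, ι' m₀ + toZ (g : Fin n →₀ ℕ) = 0) :
    ∃ Ψ : AddMonoidAlgebra κ M ≃ₐ[κ] Localization.Away (AddMonoidAlgebra.single g (1 : κ)),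
      ∀ (m : M) (q : ↥Q) (k : ℕ), ι' m + k • toZ (g : Fin n →₀ ℕ) = toZ (q : Fin n →₀ ℕ) →
        Ψ (AddMonoidAlgebra.single m 1) * algebraMap _ _ (AddMonoidAlgebra.single g (1 : κ) ^ k) =
          algebraMap _ _ (AddMonoidAlgebra.single q (1 : κ)) := by
  classical
  obtain ⟨L, Λ, hLinj, hΛinj, hL, hΛL, hΛinv⟩ := exists_algHom_away_laurent κ Q g
  have hLs : ∀ q : ↥Q, Λ (algebraMap _ (Localization.Away (AddMonoidAlgebra.single g (1 : κ))) (AddMonoidAlgebra.single q (1 : κ))) =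
      AddMonoidAlgebra.single (toZ (q : Fin n →₀ ℕ)) 1 := fun q => by rw [hΛL, hL]
  have hΛyk : ∀ k : ℕ, Λ (algebraMap _ (Localization.Away (AddMonoidAlgebra.single g (1 : κ))) (AddMonoidAlgebra.single g (1 : κ) ^ k)) =
      AddMonoidAlgebra.single (k • toZ (g : Fin n →₀ ℕ)) (1 : κ) := fun k => by
    rw [hΛL, map_pow, hL, AddMonoidAlgebra.single_pow, one_pow]
  have hΛinvk : ∀ k : ℕ, Λ (IsLocalization.Away.invSelf (AddMonoidAlgebra.single g (1 : κ)) ^ k) =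
      AddMonoidAlgebra.single (k • (-toZ (g : Fin n →₀ ℕ))) (1 : κ) := fun k => by
    rw [map_pow, hΛinv, AddMonoidAlgebra.single_pow, one_pow]
  -- `F m`: the element with Laurent monomial `x^{ι' m}`
  have hF : ∀ m : M, ∃ z : Localization.Away (AddMonoidAlgebra.single g (1 : κ)), Λ z = AddMonoidAlgebra.single (ι' m) 1 := by
    intro m
    obtain ⟨q, k, hq⟩ := hM m
    refine ⟨algebraMap _ _ (AddMonoidAlgebra.single q (1 : κ)) * IsLocalization.Away.invSelf (AddMonoidAlgebra.single g (1 : κ)) ^ k, ?_⟩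
    rw [map_mul, hLs, hΛinvk, AddMonoidAlgebra.single_mul_single, mul_one, ← hq, smul_neg, add_neg_cancel_right]
  choose F hFΛ using hF
  have hF0 : F 0 = 1 := hΛinj (by rw [hFΛ, map_zero, map_one, AddMonoidAlgebra.one_def])
  have hFadd : ∀ a b, F (a + b) = F a * F b := fun a b =>
    hΛinj (by rw [hFΛ, map_mul, hFΛ, hFΛ, AddMonoidAlgebra.single_mul_single, mul_one, map_add])
  let Fm : Multiplicative M →* Localization.Away (AddMonoidAlgebra.single g (1 : κ)) :=
    { toFun := fun q => F q.toAdd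
      map_one' := hF0
      map_mul' := fun a b => hFadd a.toAdd b.toAdd }
  let Φ : AddMonoidAlgebra κ M →ₐ[κ] Localization.Away (AddMonoidAlgebra.single g (1 : κ)) :=
    AddMonoidAlgebra.lift κ (Localization.Away (AddMonoidAlgebra.single g (1 : κ))) M Fm
  have hΦs : ∀ (m : M) (c : κ), Φ (AddMonoidAlgebra.single m c) = c • F m := fun m c => by
    change AddMonoidAlgebra.lift κ _ M Fm (AddMonoidAlgebra.single m c) = _
    rw [AddMonoidAlgebra.lift_single]
    rfl
  have hΛΦ : ∀ x, Λ (Φ x) = AddMonoidAlgebra.mapDomain ι' x := by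
    intro x
    induction x using AddMonoidAlgebra.induction_linear with
    | zero => rw [map_zero, map_zero, AddMonoidAlgebra.mapDomain_zero]
    | add f g' hf hg => rw [map_add, map_add, hf, hg, AddMonoidAlgebra.mapDomain_add]
    | single m c =>
      rw [hΦs, map_smul, hFΛ, AddMonoidAlgebra.mapDomain_single, AddMonoidAlgebra.smul_single', mul_one]
  have hΦinj : Function.Injective Φ := by
    intro a b hab
    have h := congrArg Λ hab
    rw [hΛΦ, hΛΦ] at h
    exact AddMonoidAlgebra.mapDomain_injective hι' h
  -- surjectivity: `a / (χᵍ)^k` is hit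
  have hA : ∀ a : AddMonoidAlgebra κ ↥Q, algebraMap _ (Localization.Away (AddMonoidAlgebra.single g (1 : κ))) a ∈ Set.range Φ := by
    intro a
    induction a using AddMonoidAlgebra.induction_linear with
    | zero => exact ⟨0, by rw [map_zero, map_zero]⟩
    | add f g' hf hg =>
      obtain ⟨u, hu⟩ := hf
      obtain ⟨v, hv⟩ := hg
      exact ⟨u + v, by rw [map_add, map_add, hu, hv]⟩
    | single q c =>
      obtain ⟨m, hm⟩ := hQM q
      refine ⟨AddMonoidAlgebra.single m c, hΛinj ?_⟩
      rw [hΛΦ, AddMonoidAlgebra.mapDomain_single, hm, hΛL]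
      have : AddMonoidAlgebra.single q c = c • AddMonoidAlgebra.single q (1 : κ) := by
        rw [AddMonoidAlgebra.smul_single', mul_one]
      rw [this, map_smul, hL, AddMonoidAlgebra.smul_single', mul_one]
  obtain ⟨m₀, hm₀⟩ := hgM
  have hinv : IsLocalization.Away.invSelf (AddMonoidAlgebra.single g (1 : κ)) = Φ (AddMonoidAlgebra.single m₀ 1) := hΛinj (by
    rw [hΛinv, hΛΦ, AddMonoidAlgebra.mapDomain_single, eq_neg_of_add_eq_zero_left hm₀])
  have hΦsurj : Function.Surjective Φ := by
    intro z
    obtain ⟨⟨a, ⟨_, k, rfl⟩⟩, rfl⟩ := IsLocalization.mk'_surjective (Submonoid.powers (AddMonoidAlgebra.single g (1 : κ))) z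
    obtain ⟨u, hu⟩ := hA a
    refine ⟨u * AddMonoidAlgebra.single m₀ 1 ^ k, ?_⟩
    rw [map_mul, map_pow, hu, ← hinv]
    have hunit : IsUnit (algebraMap _ (Localization.Away (AddMonoidAlgebra.single g (1 : κ))) (AddMonoidAlgebra.single g (1 : κ) ^ k)) :=
      IsLocalization.map_units (Localization.Away (AddMonoidAlgebra.single g (1 : κ)))
        (⟨AddMonoidAlgebra.single g (1 : κ) ^ k, k, rfl⟩ : Submonoid.powers (AddMonoidAlgebra.single g (1 : κ)))
    refine hunit.mul_left_inj.mp ?_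
    have e1 : IsLocalization.mk' (Localization.Away (AddMonoidAlgebra.single g (1 : κ))) a
        (⟨AddMonoidAlgebra.single g (1 : κ) ^ k, k, rfl⟩ : Submonoid.powers (AddMonoidAlgebra.single g (1 : κ))) *
        algebraMap _ _ (AddMonoidAlgebra.single g (1 : κ) ^ k) = algebraMap _ _ a :=
      IsLocalization.mk'_spec _ a _
    have e2 : algebraMap _ (Localization.Away (AddMonoidAlgebra.single g (1 : κ))) a *
        IsLocalization.Away.invSelf (AddMonoidAlgebra.single g (1 : κ)) ^ k *
        algebraMap _ _ (AddMonoidAlgebra.single g (1 : κ) ^ k) = algebraMap _ _ a := by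
      rw [map_pow, mul_assoc, ← mul_pow, mul_comm (IsLocalization.Away.invSelf _), IsLocalization.Away.mul_invSelf, one_pow, mul_one]
    rw [e2, e1]
  refine ⟨AlgEquiv.ofBijective Φ ⟨hΦinj, hΦsurj⟩, fun m q k hk => ?_⟩
  change Φ (AddMonoidAlgebra.single m 1) * _ = _
  apply hΛinj
  rw [map_mul, hΦs, one_smul, hFΛ, hΛyk, AddMonoidAlgebra.single_mul_single, mul_one, hk, hLs]

/-- ★★ **`κ[Q][1/χᵍ]` is a regular ring iff `κ[M]` is**, for `M ≅ Q − ℕg` as in `exists_algEquiv_away`. [folklore] -/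
theorem isRegularRing_away_iff_of_monoid (g : ↥Q) {M : Type} [AddCommMonoid M] (ι' : M →+ (Fin n →₀ ℤ))
    (hι' : Function.Injective ι')
    (hM : ∀ m : M, ∃ (q : ↥Q) (k : ℕ), ι' m + k • toZ (g : Fin n →₀ ℕ) = toZ (q : Fin n →₀ ℕ))
    (hQM : ∀ q : ↥Q, ∃ m : M, ι' m = toZ (q : Fin n →₀ ℕ)) (hgM : ∃ m₀ : M, ι' m₀ + toZ (g : Fin n →₀ ℕ) = 0) :
    IsRegularRing (Localization.Away (AddMonoidAlgebra.single g (1 : κ))) ↔ IsRegularRing (AddMonoidAlgebra κ M) := by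
  obtain ⟨Ψ, -⟩ := exists_algEquiv_away κ Q g ι' hι' hM hQM hgM
  exact ⟨fun _ => IsRegularRing.of_ringEquiv Ψ.toRingEquiv.symm, fun _ => IsRegularRing.of_ringEquiv Ψ.toRingEquiv⟩

end Summit.ResolutionOfSingularities.ResolutionOfSingularities.Theorems.FRationalResolution.MonoidAlgebraLaurent

end
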